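import Summits.Schanuel.Schanuel.Theses.RoyCriterion
import Summits.Schanuel.Schanuel.Theorems.RoyCriterionRankOne

/-!
# Schanuel / RoyCriterion — `RoyCriterionRankOne` (item `stmt-Schanuel-0465`): Roy's criterion in rank one

Route `Schanuel/RoyCriterion`, support item `stmt-Schanuel-0465` (`roy_criterion_rank_one`; route
declaration `Summit.Schanuel.Schanuel.Theses.RoyCriterion.RoyCriterionRankOne`, which unfolds to
`Literature.NumberTheory.Transcendental.RoyCriterion 1`): Roy's Conjecture 2 in rank `l = 1` — if
`y ≠ 0`, `α ≠ 0`, `(s₀,s₁,t₀,t₁,u)` is admissible and, for all large `N`, auxiliary polynomials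
`P_N ∈ ℤ[X₀,X₁]` of the prescribed partial degrees and height have the `D^k`-small-value property at
the points `(m y, α^m)`, `0 ≤ k ≤ N^{s₀}`, `0 ≤ m ≤ N^{s₁}`, then `trdeg_ℚ ℚ(y, α) ≥ 1`.

This is a THEOREM in print (Roy 2001, Acta Arith. 97, p. 184: "In particular, Conjecture 2 is true in
the case l = 1"): Roy's equivalence `RoyCriterion l ↔ SchanuelRank l` (Roy 2001, §1 + Thm 1 + §5),
proved in tree as `Literature.NumberTheory.Transcendental.Roy2001_iff_holds`
(`Literature/NumberTheory/Transcendental/RoyCriterionProp3Proofs.lean`, sorry-free), reduces rank one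
to Schanuel's conjecture in rank one, which is Hermite–Lindemann, proved in tree as
`Literature.NumberTheory.Transcendental.transcendental_exp_holds`
(`Literature/NumberTheory/Transcendental/LindemannWeierstrassProofs.lean`, sorry-free). The packaging
`Literature.Transcend.royCriterion_one_of_facts : Roy2001_iff → transcendental_exp → RoyCriterion 1`
is `Theorems/RoyCriterionRankOne.lean`; here both hypotheses are discharged, so the result is
UNCONDITIONAL and is stated against the route declaration by name.

Not here: the METHOD question of the route (whether small value estimates on `𝔾ₐ×𝔾ₘ` reach Roy's
window directly, Roy 2013 Thm 1.1 covering a sub-window only) — that content is carried by the cruxes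
`RoySmallValueDirichletGap` / `NguyenRoySmallValueTranslates`. The rfl-twin item `stmt-Schanuel-0080`
is closed separately in `Theorems/RoyCriterionRoySmallValueGaGmRankOneFullWindow.lean`.
-/

-- single-conjunct summit: `Summit.Schanuel.Schanuel.…` is the mandated namespace (CONVENTIONS §1, D-0017)
set_option linter.dupNamespace false

namespace Summit.Schanuel.Schanuel.Theorems.RoyCriterion

/-- Settles `stmt-Schanuel-0465`: the route declaration
`Summit.Schanuel.Schanuel.Theses.RoyCriterion.RoyCriterionRankOne` (= `RoyCriterion 1`, Roy's
Conjecture 2 in rank one) holds, unconditionally: Roy's equivalence at `l = 1` (Roy 2001, Thm 1 / §5;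
tree theorem `Roy2001_iff_holds`) and Hermite–Lindemann (tree theorem `transcendental_exp_holds`),
packaged by `Literature.Transcend.royCriterion_one_of_facts`. [cite: Roy2001, §1 p. 184] -/
theorem RoyCriterionRankOne_proof :
    Summit.Schanuel.Schanuel.Theses.RoyCriterion.RoyCriterionRankOne := by
  unfold Summit.Schanuel.Schanuel.Theses.RoyCriterion.RoyCriterionRankOne
  exact Literature.Transcend.royCriterion_one_of_facts
    Literature.NumberTheory.Transcendental.Roy2001_iff_holds
    Literature.NumberTheory.Transcendental.transcendental_exp_holds

end Summit.Schanuel.Schanuel.Theorems.RoyCriterion
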